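import Literature.Computability.Complexity.Williams2014Collapse
import Literature.Computability.Complexity.Williams2014AccSat
import HarnessLib

/-!
# Printing the explicit `SYM⁺` circuit: postfix tokens, stack expansion, sorted monomials

R. Williams, *Nonuniform ACC circuit lower bounds*, J. ACM 61 (2014), Appendix A, Transformation 4
("write the resulting polynomial as a sum of monomials … each monomial is an AND, the sum is fed to
the symmetric gate"). The explicit collapsed formula `BT.Setup.Rk` of `Williams2014Collapse.lean` is
an `AForm` tree obtained by iterated substitution; the conversion ALGORITHM manipulates it as a flat
postfix (reverse Polish) token string and expands it into monomials with one stack pass. This file is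
the (machine-free) combinatorics of that representation:

* `Tok`, `rpn` — postfix tokens of a formula over the collapse variables `V n` (inputs `inp i`, gate /
  auxiliary variables `gv c j q`, constants, `+`, `×`); `rpn_subst` — substitution is `flatMap` on
  tokens; `rpn_sumL`, `rpn_prodL`, `rpn_pow`, `rpn_oneSub`, `rpn_toda(Iter)` — the token strings of
  the derived connectives (the equations the polynomial-time program mirrors);
* `key`, `keys` — variables as naturals (`inl i ↦ 2i`, `inr (c,j,q) ↦ 2·⟨c,j,q⟩+1`), a monomial as
  the increasing list of its keys; `sinsert`, `smerge` — union of monomials on sorted lists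
  (`smerge_keys`);
* `stackStep`, `runToks`, `expandK` — the stack machine and **`runToks_rpn`**: running the tokens of
  `F` pushes `expandK F = F.expand` with keyed monomials, in the order of `AForm.expand`;
* `termsCode`, `sizeCode`, `tableCode`, `symPlusCode` and **`symPlusCodeList_explicitSymPlus`** — the
  code `symPlusCodeList` (`Williams2014AccSat.lean`) of the explicit circuit `explicitSymPlus`, read off
  the keyed expansion of `Rk Lmax` (input keys halve to the variable indices, in increasing order).

No new named fact; everything is proved.

## References

* R. Williams, *Nonuniform ACC circuit lower bounds*, J. ACM 61 (2014), Appendix A [Williams2014].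
* R. Beigel, J. Tarui, *On ACC*, Comput. Complexity 4 (1994), Thm. 1.1 [BeigelTarui1994].
-/

namespace Literature.Computability.Complexity

open Finset

namespace BT

/-! ### Postfix tokens -/

/-- Postfix tokens of integer formulas over the collapse variables: input variable `i`, gate /
auxiliary variable `(c, j, q)`, integer constant, `+`, `×`. [folklore] -/
inductive Tok : Type
  | inp (i : ℕ)
  | gv (c j q : ℕ)
  | cst (z : ℤ)
  | add
  | mul
  deriving DecidableEq

variable {n : ℕ}

/-- The postfix (reverse Polish) token string of a formula. [folklore] -/
def rpn : AForm (V n) → List Tok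
  | .var (.inl i) => [Tok.inp i]
  | .var (.inr (c, j, q)) => [Tok.gv c j q]
  | .cst z => [Tok.cst z]
  | .add F G => rpn F ++ (rpn G ++ [Tok.add])
  | .mul F G => rpn F ++ (rpn G ++ [Tok.mul])

/-- The token string of a variable. [folklore] -/
def varTok : V n → Tok
  | .inl i => Tok.inp i
  | .inr (c, j, q) => Tok.gv c j q

/-- `rpn (var v) = [varTok v]`. [folklore] -/
@[simp] theorem rpn_var (v : V n) : rpn (AForm.var v) = [varTok v] := by
  rcases v with i | ⟨c, j, q⟩ <;> rfl

/-- `rpn` is never empty. [folklore] -/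
theorem rpn_ne_nil : ∀ F : AForm (V n), rpn F ≠ []
  | .var v => by simp
  | .cst _ => by simp [rpn]
  | .add F G => by simp [rpn]
  | .mul F G => by simp [rpn]

/-- **Substitution is `flatMap` on tokens**: if `σ` sends the token of every variable to the tokens
of its image and fixes the other tokens, then `rpn (F.subst τ) = (rpn F).flatMap σ`. [folklore] -/
theorem rpn_subst (τ : V n → AForm (V n)) (σ : Tok → List Tok) (hvar : ∀ v, σ (varTok v) = rpn (τ v))
    (hcst : ∀ z, σ (Tok.cst z) = [Tok.cst z]) (hadd : σ Tok.add = [Tok.add]) (hmul : σ Tok.mul = [Tok.mul]) :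
    ∀ F : AForm (V n), rpn (F.subst τ) = (rpn F).flatMap σ
  | .var v => by rw [AForm.subst, rpn_var, List.flatMap_singleton, hvar]
  | .cst z => by simp [AForm.subst, rpn, hcst]
  | .add F G => by
    simp [AForm.subst, rpn, rpn_subst τ σ hvar hcst hadd hmul F, rpn_subst τ σ hvar hcst hadd hmul G,
      List.flatMap_append, hadd]
  | .mul F G => by
    simp [AForm.subst, rpn, rpn_subst τ σ hvar hcst hadd hmul F, rpn_subst τ σ hvar hcst hadd hmul G,
      List.flatMap_append, hmul]

/-- Tokens of a list sum: the summands, a `0`, and as many `+`. [folklore] -/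
theorem rpn_sumL : ∀ l : List (AForm (V n)),
    rpn (AForm.sumL l) = l.flatMap rpn ++ (Tok.cst 0 :: List.replicate l.length Tok.add)
  | [] => rfl
  | F :: l => by
    rw [AForm.sumL, rpn, rpn_sumL l, List.flatMap_cons, List.length_cons, List.append_assoc,
      List.append_assoc, List.cons_append, List.replicate_succ']

/-- Tokens of a list product: the factors, a `1`, and as many `×`. [folklore] -/
theorem rpn_prodL : ∀ l : List (AForm (V n)),
    rpn (AForm.prodL l) = l.flatMap rpn ++ (Tok.cst 1 :: List.replicate l.length Tok.mul)
  | [] => rfl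
  | F :: l => by
    rw [AForm.prodL, rpn, rpn_prodL l, List.flatMap_cons, List.length_cons, List.append_assoc,
      List.append_assoc, List.cons_append, List.replicate_succ']

/-- Tokens of a power. [folklore] -/
theorem rpn_pow (F : AForm (V n)) (k : ℕ) :
    rpn (F.pow k) = (List.replicate k (rpn F)).flatten ++ (Tok.cst 1 :: List.replicate k Tok.mul) := by
  rw [AForm.pow, rpn_prodL, List.length_replicate, List.flatMap_replicate]

/-- Tokens of `1 - F`. [folklore] -/
theorem rpn_oneSub (F : AForm (V n)) :
    rpn F.oneSub = Tok.cst 1 :: (Tok.cst (-1) :: (rpn F ++ [Tok.mul])) ++ [Tok.add] := by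
  simp [AForm.oneSub, AForm.neg, rpn]

/-- Tokens of the amplification step `3F² - 2F³`. [cite: BeigelTarui1994, §2.3] -/
theorem rpn_toda (F : AForm (V n)) :
    rpn F.toda = (Tok.cst 3 :: (rpn F ++ (rpn F ++ [Tok.mul]) ++ [Tok.mul])) ++
      ((Tok.cst (-2) :: (rpn F ++ (rpn F ++ (rpn F ++ [Tok.mul]) ++ [Tok.mul]) ++ [Tok.mul])) ++ [Tok.add]) := by
  simp [AForm.toda, rpn]

/-- The token-level amplification step. [cite: BeigelTarui1994, §2.3] -/
def todaToks (f : List Tok) : List Tok :=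
  (Tok.cst 3 :: (f ++ (f ++ [Tok.mul]) ++ [Tok.mul])) ++
    ((Tok.cst (-2) :: (f ++ (f ++ (f ++ [Tok.mul]) ++ [Tok.mul]) ++ [Tok.mul])) ++ [Tok.add])

/-- Tokens of the iterated amplification: iterate `todaToks`. [cite: BeigelTarui1994, §2.3] -/
theorem rpn_todaIter (F : AForm (V n)) : ∀ κ, rpn (AForm.todaIter κ F) = todaToks^[κ] (rpn F)
  | 0 => rfl
  | κ + 1 => by
    rw [AForm.todaIter, rpn_toda, Function.iterate_succ_apply', ← rpn_todaIter F κ]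
    rfl

/-! ### Keyed monomials -/

/-- A collapse variable as a natural: inputs are even, gate / auxiliary variables odd. [folklore] -/
def key : V n → ℕ
  | .inl i => 2 * (i : ℕ)
  | .inr (c, j, q) => 2 * Nat.pair c (Nat.pair j q) + 1

/-- `key` is injective. [folklore] -/
theorem key_injective : Function.Injective (key (n := n)) := by
  rintro (i | ⟨c, j, q⟩) (i' | ⟨c', j', q'⟩) h <;> simp only [key] at h
  · exact congrArg Sum.inl (Fin.ext (by omega))
  · omega
  · omega
  · have h1 : Nat.pair c (Nat.pair j q) = Nat.pair c' (Nat.pair j' q') := by omega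
    simp only [Nat.pair_eq_pair] at h1
    obtain ⟨rfl, rfl, rfl⟩ := h1
    rfl

/-- The keys of a monomial, in increasing order. [folklore] -/
def keys (A : Finset (V n)) : List ℕ := (A.image key).sort (· ≤ ·)

/-- Inserting into a strictly increasing list of naturals. [folklore] -/
def sinsert (x : ℕ) (l : List ℕ) : List ℕ := l.filter (· < x) ++ x :: l.filter (x < ·)

/-- Union of strictly increasing lists of naturals, by repeated insertion. [folklore] -/
def smerge (l₁ l₂ : List ℕ) : List ℕ := l₂.foldl (fun acc x => sinsert x acc) l₁

/-- `sinsert` on a sorted set is the sorted set with the element inserted. [folklore] -/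
theorem sinsert_sort (x : ℕ) (s : Finset ℕ) : sinsert x (s.sort (· ≤ ·)) = (insert x s).sort (· ≤ ·) := by
  set l := s.sort (· ≤ ·) with hl
  have hln : l.Nodup := Finset.sort_nodup _ _
  have hlp : l.Pairwise (· ≤ ·) := Finset.pairwise_sort _ _
  have hmem : ∀ a, a ∈ l ↔ a ∈ s := fun a => Finset.mem_sort _
  have hset : (sinsert x l).toFinset = insert x s := by
    ext a
    simp only [sinsert, List.mem_toFinset, List.mem_append, List.mem_filter, List.mem_cons,
      decide_eq_true_eq, Finset.mem_insert, hmem]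
    rcases lt_trichotomy a x with h | h | h
    · constructor
      · rintro (⟨ha, -⟩ | rfl | ⟨ha, -⟩) <;> simp_all
      · rintro (rfl | ha) <;> simp_all
    · subst h; simp
    · constructor
      · rintro (⟨ha, -⟩ | rfl | ⟨ha, -⟩) <;> simp_all
      · rintro (rfl | ha)
        · simp
        · exact Or.inr (Or.inr ⟨ha, h⟩)
  have hnd : (sinsert x l).Nodup := by
    simp only [sinsert, List.nodup_append, List.nodup_cons, List.mem_filter, decide_eq_true_eq,
      lt_self_iff_false, and_false, not_false_eq_true, true_and, List.mem_cons]
    refine ⟨hln.filter _, hln.filter _, ?_⟩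
    rintro a ⟨-, ha⟩ b (rfl | ⟨-, hb⟩) <;> omega
  have hpw : (sinsert x l).Pairwise (· ≤ ·) := by
    simp only [sinsert, List.pairwise_append, List.pairwise_cons, List.mem_filter, decide_eq_true_eq,
      List.mem_cons]
    refine ⟨hlp.filter _, ⟨fun b hb => hb.2.le, hlp.filter _⟩, ?_⟩
    rintro a ⟨-, ha⟩ b (rfl | ⟨-, hb⟩) <;> omega
  rw [← hset]
  exact ((List.toFinset_sort (· ≤ ·) hnd).2 hpw).symm

/-- **`smerge` of two sorted sets is the sorted union.** [folklore] -/
theorem smerge_sort (s t : Finset ℕ) : smerge (s.sort (· ≤ ·)) (t.sort (· ≤ ·)) = (s ∪ t).sort (· ≤ ·) := by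
  suffices h : ∀ (l : List ℕ) (s : Finset ℕ), smerge (s.sort (· ≤ ·)) l = (s ∪ l.toFinset).sort (· ≤ ·) by
    rw [h, Finset.sort_toFinset]
  intro l
  induction l with
  | nil => intro s; simp [smerge]
  | cons x l ih =>
    intro s
    rw [smerge, List.foldl_cons, sinsert_sort, ← smerge, ih]
    congr 1
    ext a; simp

/-- Keys of a union of monomials. [folklore] -/
theorem smerge_keys (A B : Finset (V n)) : smerge (keys A) (keys B) = keys (A ∪ B) := by
  rw [keys, keys, smerge_sort, keys, Finset.image_union]

/-- Keys of a single variable. [folklore] -/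
@[simp] theorem keys_singleton (v : V n) : keys ({v} : Finset (V n)) = [key v] := by
  rw [keys, Finset.image_singleton, Finset.sort_singleton]

/-- Keys of the empty monomial. [folklore] -/
@[simp] theorem keys_empty : keys (∅ : Finset (V n)) = [] := by
  rw [keys, Finset.image_empty, Finset.sort_empty]

/-- The number of keys is the number of variables. [folklore] -/
theorem length_keys (A : Finset (V n)) : (keys A).length = A.card := by
  rw [keys, Finset.length_sort, Finset.card_image_of_injective _ key_injective]

/-! ### The stack expansion -/

/-- Keyed polynomials: signed monomials with increasing key lists. [folklore] -/
abbrev KPoly : Type := List (ℤ × List ℕ)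

/-- Product of keyed polynomials, in the order of `AForm.expand`. [folklore] -/
def pmul (F G : KPoly) : KPoly := F.flatMap fun p => G.map fun q => (p.1 * q.1, smerge p.2 q.2)

/-- One step of the stack machine reading postfix tokens. [folklore] -/
def stackStep : List KPoly → Tok → List KPoly
  | st, Tok.inp i => [((1 : ℤ), [2 * i])] :: st
  | st, Tok.gv c j q => [((1 : ℤ), [2 * Nat.pair c (Nat.pair j q) + 1])] :: st
  | st, Tok.cst z => [(z, ([] : List ℕ))] :: st
  | G :: F :: st, Tok.add => (F ++ G) :: st
  | G :: F :: st, Tok.mul => pmul F G :: st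
  | st, _ => st

/-- Running the stack machine on a token string. [folklore] -/
def runToks (toks : List Tok) (st : List KPoly) : List KPoly := toks.foldl stackStep st

/-- The keyed expansion of a formula: `expand` with monomials replaced by their key lists. [folklore] -/
def expandK (F : AForm (V n)) : KPoly := F.expand.map fun q => (q.1, keys q.2)

/-- `runToks` on a concatenation. [folklore] -/
theorem runToks_append (t₁ t₂ : List Tok) (st : List KPoly) :
    runToks (t₁ ++ t₂) st = runToks t₂ (runToks t₁ st) := List.foldl_append

/-- **The stack machine expands formulas**: running the tokens of `F` on top of any stack pushes
the keyed expansion of `F`. [folklore] -/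
theorem runToks_rpn : ∀ (F : AForm (V n)) (rest : List Tok) (st : List KPoly),
    runToks (rpn F ++ rest) st = runToks rest (expandK F :: st)
  | .var (.inl i), rest, st => by
    simp [rpn, runToks, stackStep, expandK, AForm.expand, key]
  | .var (.inr (c, j, q)), rest, st => by
    simp [rpn, runToks, stackStep, expandK, AForm.expand, key]
  | .cst z, rest, st => by
    simp [rpn, runToks, stackStep, expandK, AForm.expand]
  | .add F G, rest, st => by
    rw [rpn, List.append_assoc, runToks_rpn F, List.append_assoc, runToks_rpn G, List.singleton_append]
    simp only [runToks, List.foldl_cons, stackStep]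
    simp [expandK, AForm.expand]
  | .mul F G, rest, st => by
    rw [rpn, List.append_assoc, runToks_rpn F, List.append_assoc, runToks_rpn G, List.singleton_append]
    simp only [runToks, List.foldl_cons, stackStep]
    congr 2
    simp only [expandK, AForm.expand, pmul, List.map_flatMap, List.flatMap_map, List.map_map]
    congr 1
    funext p
    congr 1
    funext q
    simp [smerge_keys]

/-- The keyed expansion of a formula from its tokens: run on the empty stack and read the top.
[folklore] -/
def expandToks (toks : List Tok) : KPoly := (runToks toks []).headD []

/-- `expandToks (rpn F) = expandK F`. [folklore] -/
theorem expandToks_rpn (F : AForm (V n)) : expandToks (rpn F) = expandK F := by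
  have h := runToks_rpn F [] []
  rw [List.append_nil] at h
  rw [expandToks, h]
  rfl

/-! ### The code of the explicit `SYM⁺` circuit -/

/-- The flattened code of the AND-terms read off a keyed polynomial: a monomial with coefficient
`a` contributes `a mod M` copies of `card :: indices` (input keys halved). [folklore] -/
def termsCode (P : KPoly) (M : ℕ) : List ℕ :=
  P.flatMap fun q => (List.replicate ((q.1 % (M : ℤ)).toNat) (q.2.length :: q.2.map (· / 2))).flatten

/-- The number of AND-terms read off a keyed polynomial. [folklore] -/
def sizeCode (P : KPoly) (M : ℕ) : ℕ := (P.map fun q => (q.1 % (M : ℤ)).toNat).sum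

/-- A monomial in the inputs is the image of its input part. [folklore] -/
theorem eq_map_toIn (A : Finset (V n)) (hA : ∀ v ∈ A, ∃ i, v = Sum.inl i) :
    A = (Setup.toIn A).map ⟨Sum.inl, Sum.inl_injective⟩ := by
  ext v
  simp only [Setup.toIn, Finset.mem_map, Finset.mem_filter, Finset.mem_univ, true_and,
    Function.Embedding.coeFn_mk]
  constructor
  · intro hv
    obtain ⟨i, rfl⟩ := hA v hv
    exact ⟨i, hv, rfl⟩
  · rintro ⟨i, hi, rfl⟩
    exact hi

/-- **Keys of a monomial in the inputs**: twice the variable indices, in increasing order. [folklore] -/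
theorem keys_eq_map_sort_toIn (A : Finset (V n)) (hA : ∀ v ∈ A, ∃ i, v = Sum.inl i) :
    keys A = ((Setup.toIn A).sort (· ≤ ·)).map fun i : Fin n => 2 * (i : ℕ) := by
  have hmap : A.image key = (Setup.toIn A).map ⟨fun i : Fin n => 2 * (i : ℕ), fun i j h => Fin.ext (by simpa using h)⟩ := by
    conv_lhs => rw [eq_map_toIn A hA]
    rw [Finset.map_eq_image, Finset.map_eq_image, Finset.image_image]
    rfl
  rw [keys, hmap]
  exact (Finset.map_sort _ _ (· ≤ ·) (· ≤ ·) fun a _ b _ => by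
    show a ≤ b ↔ 2 * (a : ℕ) ≤ 2 * (b : ℕ)
    rw [Fin.le_iff_val_le_val]; omega).symm

/-- The code of one AND-term in the inputs from its keys. [folklore] -/
theorem termCode_eq (A : Finset (V n)) (hA : ∀ v ∈ A, ∃ i, v = Sum.inl i) :
    (Setup.toIn A).card :: (((Setup.toIn A).sort (· ≤ ·)).map Fin.val) =
      (keys A).length :: (keys A).map (· / 2) := by
  rw [keys_eq_map_sort_toIn A hA, List.length_map, Finset.length_sort, List.map_map]
  congr 1
  exact List.map_congr_left fun i _ => by simp

/-- **The number of AND-terms of `termsOf`** is `sizeCode` of the keyed expansion. [folklore] -/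
theorem length_termsOf (R : AForm (V n)) (M : ℕ) : (Setup.termsOf R M).length = sizeCode (expandK R) M := by
  rw [Setup.termsOf, Setup.length_flatMap_replicate, sizeCode, expandK, List.map_map]
  rfl

/-- **The flattened code of the AND-terms of `termsOf`** is `termsCode` of the keyed expansion,
for a formula in the inputs. [folklore] -/
theorem flatMap_termsOf (R : AForm (V n)) (M : ℕ) (hR : R.VarsIn fun v => ∃ i, v = Sum.inl i) :
    (Setup.termsOf R M).flatMap (fun t => t.card :: (t.sort (· ≤ ·)).map Fin.val) =
      termsCode (expandK R) M := by
  rw [Setup.termsOf, List.flatMap_assoc, termsCode, expandK, List.flatMap_map]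
  refine List.flatMap_congr fun q hq => ?_
  have hq' := AForm.forall_mem_expand_of_varsIn hR q hq
  simp only [List.flatMap_replicate]
  rw [termCode_eq q.2 hq']

/-- **The code of the explicit `SYM⁺` circuit** (`symPlusCodeList`, `Williams2014AccSat.lean`): the
number of inputs, the number of AND-terms, the terms, and the table of the symmetric gate on the
counts `0, …, size`, all read off the keyed expansion of the collapsed formula (which mentions
inputs only) and the arithmetic of `symOf`. [cite: Williams2014, Lemma 4.1 and Appendix A] -/
theorem symPlusCodeList_explicitSymPlus (K : Setup n) {T lam a e₀ Lmax : ℕ}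
    (hvars : (K.Rk T lam a e₀ Lmax Lmax).VarsIn (fun v => K.Adm v ∧ K.level v ≤ 0)) :
    symPlusCodeList (K.explicitSymPlus T lam a e₀ Lmax) =
      n :: sizeCode (expandK (K.Rk T lam a e₀ Lmax Lmax)) (Setup.Kf lam a e₀ Lmax) ::
        termsCode (expandK (K.Rk T lam a e₀ Lmax Lmax)) (Setup.Kf lam a e₀ Lmax) ++
        (List.range (sizeCode (expandK (K.Rk T lam a e₀ Lmax Lmax)) (Setup.Kf lam a e₀ Lmax) + 1)).map
          fun N => if K.symOf T lam a e₀ Lmax N then 1 else 0 := by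
  have hinp : (K.Rk T lam a e₀ Lmax Lmax).VarsIn fun v => ∃ i, v = Sum.inl i :=
    hvars.mono fun v hv => K.exists_inl_of_level hv.1 (Nat.le_zero.1 hv.2)
  have hsize : (K.explicitSymPlus T lam a e₀ Lmax).size =
      sizeCode (expandK (K.Rk T lam a e₀ Lmax Lmax)) (Setup.Kf lam a e₀ Lmax) := length_termsOf _ _
  rw [symPlusCodeList, hsize]
  show n :: _ :: (Setup.termsOf (K.Rk T lam a e₀ Lmax Lmax) (Setup.Kf lam a e₀ Lmax)).flatMap _ ++ _ = _
  rw [flatMap_termsOf _ _ hinp]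
  rfl

end BT

end Literature.Computability.Complexity
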